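import Literature.MathematicalPhysics.QuantumFieldTheory.Balaban1983to89.B1Eq324BenfattoKernelSect5Eq513
import Literature.MathematicalPhysics.QuantumFieldTheory.Balaban1983to89.B1Eq324BenfattoCondKernelGeneric
import Literature.MathematicalPhysics.QuantumFieldTheory.Balaban1983to89.B1Eq324BenfattoSect5SlotMoments
import Literature.MathematicalPhysics.QuantumFieldTheory.Balaban1983to89.B1Eq324BenfattoClassRescale
import HarnessLib

/-!
# `Balaban1983to89.B1Eq324BenfattoClassPresentation` — PRESENTING A PRECISION ON AN ABSTRACT FINITE INDEX SET AS A CLASS MEMBER ON `ℤ^d`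
([BenfattoEtAl1978] §1 p. 144 «a family of gaussian random variables indexed by the tesserae of Q₀»; [Balaban1985BackgroundPropagators] Sect. E p. 428:
the Gaussian of `C*Δ_kC` lives on the bonds of `Λ̃` × Lie-algebra components; the class road of this cell is typed on `Q₀ = ℤ^d`)

statement-level companion of a published source with citation tags; every declaration here is a theorem; nothing here is
a claim about the Yang–Mills mass gap

WHY THIS MODULE (cell `pub-ymgap`, seat `dag-n08-b` gen 14, INTENT-3; node N08 [Balaban1985UV3]; the [BenfattoEtAl1978] source chain behind the
(α)-row `h324c`).  The class road's output (`…KernelEq324AnyGamma.eq324_kernel_of_expDecay`: (3.24) for `μ_K`, `K` the zero-extended `A⁻¹` of a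
symmetric, coercive, exponentially decaying precision `A` on a finite `Λ ⊂ ℤ^d`) and seat n08-w4's (α)-socket (`…AlphaEq324RowClassSocket(AE)`:
a PRESENTATION `(𝔖 k).μ = (μ h U).map Φ`, `Φ⁻¹'(box) =ᵐ smallFieldSet I p`) meet an instantiation whose Gaussian variables are indexed by an
ABSTRACT finite type `β` ([Balaban1985UV3]: bonds × `su(N)` components; seat n08-w4's CHECK A: «`Φ` is, up to null sets, a COORDINATE EMBEDDING»).
This file is the generic presentation kit: given a precision `T : Matrix β β ℝ` and a bijection `e : β ≃ Λ` onto a window `Λ ⊂ ℤ^d`, the re-indexed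
precision `Matrix.reindex e e T` on `Λ` (i) inherits symmetry and coercivity with the SAME constant, (ii) inherits entrywise decay stated in the
embedded Euclidean metric (a quasi-isometric `e` moves the rate and the constant: `abs_le_exp_of_dist_le`), (iii) its zero-extended inverse
kernel `K` reads `T⁻¹` on the image, (iv) the Gaussian field `μ_K` on `ℤ^d → ℝ` PRESENTS `𝒩(0, T⁻¹)` on `β → ℝ` under `Φ z = z ∘ e`
(`(μ_K).map Φ = μ_{T⁻¹}`, by seat n08-c's `gaussianFieldOfKernel_map_reindex`), and (v) the uniform-threshold box on `β` pulls back, up to a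
`μ_K`-null set, to the class road's `smallFieldSet Λ p` (thresholds `p(1 + d(Λ, x))`: `= p` on `Λ`, irrelevant off `Λ` where the field vanishes a.s.,
`…KernelSect5Eq513.ae_forall_eval_eq_zero`) — the socket's `hbox` in its a.e. form with `I := Λ`.

WHAT IS PROVED (standard axioms; no `sorry`; no definition — the re-indexed precision is Mathlib's `Matrix.reindex e e T`, the presentation map the
lambda `fun z b => z ((e b : Λ) : Q₀)`).
* §1 `reindex_entry`, `reindex_symm`, ★ `reindex_coercive`, `reindex_abs_le`, ★ `reindex_abs_le_exp` (decay in the embedded metric), `abs_le_exp_of_dist_le`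
  (metric distortion: `|t| ≤ K e^{−κρ}`, `D ≤ C₁ρ + C₀` ⇒ `|t| ≤ K e^{κC₀/C₁}·e^{−(κ/C₁)D}`), `reindex_abs_le_exp_of_dist_le`.
* §2 ★ `kernel_reindex_apply` (`K (e b) (e b′) = T⁻¹ b b′`), `isPosSemidefKernel_presented`, `measurable_restrictAlong`,
  ★★ `map_restrictAlong_eq` (`(μ_K).map (z ↦ z ∘ e) = μ_{T⁻¹}` on `β → ℝ`), `integral_comp_restrictAlong`.
* §3 ★★ `preimage_box_ae_eq_smallFieldSet` (`Φ⁻¹'{ω | ∀ b, |ω b| ≤ p} =ᵐ[μ_K] smallFieldSet Λ p`, `p ≥ 0`), `smallFieldSet_subset_preimage_box` (the sure half).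
HONEST SCOPE.  Re-indexing bookkeeping for OUR class; which `β`, `T`, `e` present [Balaban1985UV3]'s step block (the IDENT: the member and its rows
from N06, the Hamiltonian letters, CHECK C on wrapped regions) is NOT decided, commissioned or claimed here; count-neutral for N08; nothing about
d = 4, the continuum, OS axioms, a mass gap or the Clay problem.
-/

noncomputable section

open MeasureTheory ProbabilityTheory Finset Matrix
open scoped BigOperators

namespace Literature.MathematicalPhysics.QuantumFieldTheory.Balaban1983to89.B1Eq324BenfattoClassPresentation

open _root_.MeasureTheory
open Literature.MathematicalPhysics.QuantumFieldTheory
open Literature.MathematicalPhysics.QuantumFieldTheory.Balaban1983to89.B1Eq324BenfattoLemma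
open Literature.MathematicalPhysics.QuantumFieldTheory.Balaban1983to89.B1Eq324BenfattoAppendixA (distToRegion_nonneg)
open Literature.MathematicalPhysics.QuantumFieldTheory.Balaban1983to89.B1Eq324BenfattoSect5SlotMoments (distToRegion_eq_zero_of_mem)
open Literature.MathematicalPhysics.QuantumFieldTheory.Balaban1983to89.B1Eq324BenfattoCondKernelGeneric (gaussianFieldOfKernel_map_reindex)
open Literature.MathematicalPhysics.QuantumFieldTheory.Balaban1983to89.B1Eq324BenfattoKernelOfPrecision (kernel_apply_of_mem kernel_eq_zero_of_not_mem_left)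
open Literature.MathematicalPhysics.QuantumFieldTheory.Balaban1983to89.B1Eq324BenfattoKernelSect5Eq513 (ae_forall_eval_eq_zero)
open Literature.MathematicalPhysics.QuantumFieldTheory.Balaban1983to89.B1Eq324BenfattoClassRescale (isPosSemidefKernel_of_member)

variable {d : ℕ} {β : Type*} {Λ : Finset (B1Eq324BenfattoLemma.Site d)} (e : β ≃ ↥Λ) {T : Matrix β β ℝ}

/-! ## §1  The re-indexed precision `Matrix.reindex e e T` on the window `Λ` -/

/-- The entries: `(reindex e e T) x y = T (e⁻¹x) (e⁻¹y)`. [cite: BenfattoEtAl1978, §1 p.144 (class form; ours)] -/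
theorem reindex_entry (x y : ↥Λ) : (Matrix.reindex e e T) x y = T (e.symm x) (e.symm y) := by
  simp only [Matrix.reindex_apply, Matrix.submatrix_apply]

/-- Symmetry is inherited. [cite: Balaban1985BackgroundPropagators, Sect. E p.428 (class form; ours)] -/
theorem reindex_symm (hTs : ∀ b b', T b b' = T b' b) : ∀ x y : ↥Λ, (Matrix.reindex e e T) x y = (Matrix.reindex e e T) y x := by
  intro x y
  simp only [reindex_entry, hTs (e.symm x) (e.symm y)]

/-- ★ **Coercivity is inherited with the same constant**: `γ Σ_b v_b² ≤ Σ T v v` for all `v` gives `γ Σ_x w_x² ≤ Σ (reindex e e T) w w` for all `w`.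
[cite: Balaban1985BackgroundPropagators, Sect. E p.428 «a lower bound γ₀ > 0» (class form; ours)] -/
theorem reindex_coercive [Fintype β] {γ : ℝ} (hγ : ∀ v : β → ℝ, γ * ∑ b, v b ^ 2 ≤ ∑ b, ∑ b', T b b' * v b * v b') :
    ∀ w : ↥Λ → ℝ, γ * ∑ x, w x ^ 2 ≤ ∑ x, ∑ y, (Matrix.reindex e e T) x y * w x * w y := by
  intro w
  have h := hγ (fun b => w (e b))
  have h1 : ∑ b, w (e b) ^ 2 = ∑ x, w x ^ 2 := e.sum_comp (fun x => w x ^ 2)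
  have h2 : ∑ b, ∑ b', T b b' * w (e b) * w (e b') = ∑ x, ∑ y, (Matrix.reindex e e T) x y * w x * w y := by
    rw [← e.sum_comp (fun x => ∑ y, (Matrix.reindex e e T) x y * w x * w y)]
    refine Finset.sum_congr rfl fun b _ => ?_
    rw [← e.sum_comp (fun y => (Matrix.reindex e e T) (e b) y * w (e b) * w y)]
    refine Finset.sum_congr rfl fun b' _ => ?_
    simp only [reindex_entry, Equiv.symm_apply_apply]
  rw [h1, h2] at h
  exact h

/-- Entrywise bounds are inherited. [cite: Balaban1985BackgroundPropagators, (1.16)–(1.18) p.180 (class form; ours)] -/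
theorem reindex_abs_le {g : β → β → ℝ} (hdec : ∀ b b', |T b b'| ≤ g b b') :
    ∀ x y : ↥Λ, |(Matrix.reindex e e T) x y| ≤ g (e.symm x) (e.symm y) := fun x y => by
  rw [reindex_entry]
  exact hdec _ _

/-- ★ **Decay in the embedded Euclidean metric is inherited verbatim**: `|T b b′| ≤ K_A e^{−κ_A|e b − e b′|₂}` for all `b, b′` gives the class road's decay
hypothesis `|A x y| ≤ K_A e^{−κ_A|x − y|₂}` for `A = reindex e e T`. [cite: Balaban1985BackgroundPropagators, (1.16)–(1.18) p.180, Sect. E p.428 (class form; ours)] -/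
theorem reindex_abs_le_exp {KA κA : ℝ}
    (hdec : ∀ b b', |T b b'| ≤ KA * Real.exp (-(κA * Real.sqrt (∑ j, (((((e b : ↥Λ) : B1Eq324BenfattoLemma.Site d) j : ℝ) -
      (((e b' : ↥Λ) : B1Eq324BenfattoLemma.Site d) j : ℝ))) ^ 2)))) :
    ∀ x y : ↥Λ, |(Matrix.reindex e e T) x y| ≤ KA * Real.exp (-(κA * Real.sqrt (∑ j, ((((x : B1Eq324BenfattoLemma.Site d) j : ℝ) -
      ((y : B1Eq324BenfattoLemma.Site d) j : ℝ))) ^ 2))) := by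
  intro x y
  have h := hdec (e.symm x) (e.symm y)
  simp only [Equiv.apply_symm_apply] at h
  rw [reindex_entry]
  exact h

/-- **Metric distortion**: if `|t| ≤ K e^{−κρ}` and the embedded distance satisfies `D ≤ C₁ρ + C₀` (`C₁ > 0`, `K ≥ 0`, `κ ≥ 0`), then
`|t| ≤ (K e^{κC₀/C₁})·e^{−(κ/C₁)D}` — a quasi-isometric embedding moves the decay rate to `κ/C₁` and the constant to `K e^{κC₀/C₁}`.
[cite: Balaban1985BackgroundPropagators, (1.16)–(1.18) p.180 (class form; ours)] -/
theorem abs_le_exp_of_dist_le {t K κ ρ D C₁ C₀ : ℝ} (hK : 0 ≤ K) (hκ : 0 ≤ κ) (hC₁ : 0 < C₁) (ht : |t| ≤ K * Real.exp (-(κ * ρ)))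
    (hD : D ≤ C₁ * ρ + C₀) : |t| ≤ K * Real.exp (κ * C₀ / C₁) * Real.exp (-(κ / C₁ * D)) := by
  refine ht.trans ?_
  rw [mul_assoc, ← Real.exp_add]
  refine mul_le_mul_of_nonneg_left (Real.exp_le_exp.mpr ?_) hK
  have hρ : (D - C₀) / C₁ ≤ ρ := by
    rw [div_le_iff₀ hC₁]
    linarith
  have h1 : κ / C₁ * D = κ * C₀ / C₁ + κ * ((D - C₀) / C₁) := by
    field_simp
    ring
  rw [h1]
  nlinarith [mul_le_mul_of_nonneg_left hρ hκ]

/-- **Decay in an intrinsic pseudo-distance `ρ` on `β` + a quasi-isometric embedding ⇒ decay in the embedded metric** (`reindex_abs_le_exp`'s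
hypothesis with rate `κ/C₁` and constant `K e^{κC₀/C₁}`). [cite: Balaban1985BackgroundPropagators, (1.16)–(1.18) p.180, Sect. E p.428 (class form; ours)] -/
theorem reindex_abs_le_exp_of_dist_le {K κ C₁ C₀ : ℝ} {ρ : β → β → ℝ} (hK : 0 ≤ K) (hκ : 0 ≤ κ) (hC₁ : 0 < C₁)
    (hdec : ∀ b b', |T b b'| ≤ K * Real.exp (-(κ * ρ b b')))
    (hD : ∀ b b', Real.sqrt (∑ j, (((((e b : ↥Λ) : B1Eq324BenfattoLemma.Site d) j : ℝ) - (((e b' : ↥Λ) : B1Eq324BenfattoLemma.Site d) j : ℝ))) ^ 2) ≤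
      C₁ * ρ b b' + C₀) :
    ∀ x y : ↥Λ, |(Matrix.reindex e e T) x y| ≤ K * Real.exp (κ * C₀ / C₁) * Real.exp (-(κ / C₁ * Real.sqrt (∑ j, ((((x : B1Eq324BenfattoLemma.Site d) j : ℝ) -
      ((y : B1Eq324BenfattoLemma.Site d) j : ℝ))) ^ 2))) :=
  reindex_abs_le_exp e fun b b' => abs_le_exp_of_dist_le hK hκ hC₁ (hdec b b') (hD b b')

/-! ## §2  The kernel and the Gaussian bridge -/

section Kernel

variable [Fintype β] [DecidableEq β] {K : B1Eq324BenfattoLemma.Site d → B1Eq324BenfattoLemma.Site d → ℝ}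
  (hK : ∀ x y, K x y = if h : x ∈ Λ ∧ y ∈ Λ then ((Matrix.reindex e e T)⁻¹ : Matrix ↥Λ ↥Λ ℝ) ⟨x, h.1⟩ ⟨y, h.2⟩ else 0)

include hK

/-- ★ **The zero-extended inverse kernel reads `T⁻¹` on the image**: `K (e b) (e b′) = T⁻¹ b b′` (`Matrix.inv_reindex`).
[cite: BenfattoEtAl1978, §1 p.144 (class form; ours)] -/
theorem kernel_reindex_apply (b b' : β) :
    K ((e b : ↥Λ) : B1Eq324BenfattoLemma.Site d) ((e b' : ↥Λ) : B1Eq324BenfattoLemma.Site d) = (T⁻¹ : Matrix β β ℝ) b b' := by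
  rw [hK, dif_pos ⟨(e b).2, (e b').2⟩, Matrix.inv_reindex]
  simp only [Subtype.coe_eta, Matrix.reindex_apply, Matrix.submatrix_apply, Equiv.symm_apply_apply]

omit [DecidableEq β] in
/-- The zero-extended inverse kernel of a symmetric coercive re-indexed precision is positive semidefinite.
[cite: BenfattoEtAl1978, (1.1) p.144 (class form; ours)] -/
theorem isPosSemidefKernel_presented (hTs : ∀ b b', T b b' = T b' b) {γ : ℝ} (hγ0 : 0 < γ)
    (hγ : ∀ v : β → ℝ, γ * ∑ b, v b ^ 2 ≤ ∑ b, ∑ b', T b b' * v b * v b') : IsPosSemidefKernel K :=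
  isPosSemidefKernel_of_member hK (reindex_symm e hTs) hγ0 (reindex_coercive e hγ)

omit [Fintype β] [DecidableEq β] hK in
/-- The presentation map `z ↦ z ∘ e` (read the `β`-indexed variables off the window) is measurable. [folklore]
[cite: BenfattoEtAl1978, §1 p.144 (class form; ours)] -/
theorem measurable_restrictAlong : Measurable fun (z : B1Eq324BenfattoLemma.Site d → ℝ) (b : β) => z ((e b : ↥Λ) : B1Eq324BenfattoLemma.Site d) :=
  measurable_pi_lambda _ fun _ => measurable_pi_apply _

/-- ★★ **THE GAUSSIAN BRIDGE**: under `Φ z = z ∘ e` the class road's field `μ_K` on `ℤ^d → ℝ` presents the Gaussian `𝒩(0, T⁻¹)` on `β → ℝ`: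
`(μ_K).map Φ = gaussianFieldOfKernel (T⁻¹)` (seat n08-c's `gaussianFieldOfKernel_map_reindex` + `kernel_reindex_apply`).
[cite: BenfattoEtAl1978, §1 p.144, (1.1); Balaban1985BackgroundPropagators, (3.157)–(3.158) p.428 (class form; ours)] -/
theorem map_restrictAlong_eq (hTs : ∀ b b', T b b' = T b' b) {γ : ℝ} (hγ0 : 0 < γ)
    (hγ : ∀ v : β → ℝ, γ * ∑ b, v b ^ 2 ≤ ∑ b, ∑ b', T b b' * v b * v b') :
    (gaussianFieldOfKernel K).map (fun (z : B1Eq324BenfattoLemma.Site d → ℝ) (b : β) => z ((e b : ↥Λ) : B1Eq324BenfattoLemma.Site d)) =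
      gaussianFieldOfKernel fun b b' => (T⁻¹ : Matrix β β ℝ) b b' := by
  rw [gaussianFieldOfKernel_map_reindex (isPosSemidefKernel_presented e hK hTs hγ0 hγ)
    (fun b : β => ((e b : ↥Λ) : B1Eq324BenfattoLemma.Site d))]
  congr 1
  funext b b'
  exact kernel_reindex_apply e hK b b'

/-- **Integrals transform along the presentation**: `∫ F(z ∘ e) dμ_K = ∫ F d𝒩(0,T⁻¹)` for measurable `F`.
[cite: BenfattoEtAl1978, §1 p.144 (class form; ours)] -/
theorem integral_comp_restrictAlong (hTs : ∀ b b', T b b' = T b' b) {γ : ℝ} (hγ0 : 0 < γ)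
    (hγ : ∀ v : β → ℝ, γ * ∑ b, v b ^ 2 ≤ ∑ b, ∑ b', T b b' * v b * v b') {F : (β → ℝ) → ℝ} (hF : Measurable F) :
    ∫ z, F (fun b => z ((e b : ↥Λ) : B1Eq324BenfattoLemma.Site d)) ∂gaussianFieldOfKernel K =
      ∫ ω, F ω ∂gaussianFieldOfKernel fun b b' => (T⁻¹ : Matrix β β ℝ) b b' := by
  rw [← map_restrictAlong_eq e hK hTs hγ0 hγ, integral_map (measurable_restrictAlong e).aemeasurable hF.aestronglyMeasurable]

/-! ## §3  The uniform-threshold box pulls back to the class road's small-field set, up to a null set -/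

omit [Fintype β] [DecidableEq β] hK in
/-- **The sure half**: `smallFieldSet Λ p ⊆ Φ⁻¹'{ω | ∀ b, |ω b| ≤ p}` (on `Λ` the thresholds `p(1 + d(Λ,x))` equal `p`).
[cite: BenfattoEtAl1978, (A.1) p.161; Balaban1985UV3, (18) p.260 «χ(|A(b)| < g₀p(g₀))» (class form; ours)] -/
theorem smallFieldSet_subset_preimage_box (p : ℝ) :
    smallFieldSet Λ p ⊆ (fun (z : B1Eq324BenfattoLemma.Site d → ℝ) (b : β) => z ((e b : ↥Λ) : B1Eq324BenfattoLemma.Site d)) ⁻¹'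
      {ω : β → ℝ | ∀ b, |ω b| ≤ p} := by
  intro z hz b
  have h := hz ((e b : ↥Λ) : B1Eq324BenfattoLemma.Site d)
  rwa [distToRegion_eq_zero_of_mem (e b).2, add_zero, mul_one] at h

omit [DecidableEq β] in
/-- ★★ **THE SOCKET'S BOX IDENTITY, A.E. FORM**: for `p ≥ 0`, `Φ⁻¹'{ω | ∀ b, |ω b| ≤ p} =ᵐ[μ_K] smallFieldSet Λ p` — the two sets differ only on
configurations that are non-zero off `Λ`, a `μ_K`-null set (`…KernelSect5Eq513.ae_forall_eval_eq_zero`: `K x x = 0` off `Λ`).  This is seat n08-w4's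
`hbox` (`…AlphaEq324RowClassSocketAE`) with `I := Λ` for a block whose small-field cut-off is the SAME at every variable.
[cite: BenfattoEtAl1978, (A.1) p.161; Balaban1985UV3, (18) p.260, (41) p.266 (class form; ours)] -/
theorem preimage_box_ae_eq_smallFieldSet (hTs : ∀ b b', T b b' = T b' b) {γ : ℝ} (hγ0 : 0 < γ)
    (hγ : ∀ v : β → ℝ, γ * ∑ b, v b ^ 2 ≤ ∑ b, ∑ b', T b b' * v b * v b') {p : ℝ} (hp : 0 ≤ p) :
    ((fun (z : B1Eq324BenfattoLemma.Site d → ℝ) (b : β) => z ((e b : ↥Λ) : B1Eq324BenfattoLemma.Site d)) ⁻¹' {ω : β → ℝ | ∀ b, |ω b| ≤ p})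
      =ᵐ[gaussianFieldOfKernel K] smallFieldSet Λ p := by
  have hpsd := isPosSemidefKernel_presented e hK hTs hγ0 hγ
  have hoff : ∀ x ∈ ((↑Λ : Set (B1Eq324BenfattoLemma.Site d))ᶜ), K x x = 0 :=
    fun x hx => kernel_eq_zero_of_not_mem_left hK (fun h => hx (Finset.mem_coe.mpr h)) x
  filter_upwards [ae_forall_eval_eq_zero hpsd hoff] with z hz
  refine propext ⟨fun h => ?_, fun h => smallFieldSet_subset_preimage_box e p h⟩
  intro x
  by_cases hx : x ∈ Λ
  · have hb := h (e.symm ⟨x, hx⟩)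
    simp only [Equiv.apply_symm_apply] at hb
    calc |z x| ≤ p := hb
      _ ≤ p * (1 + distToRegion Λ x) := le_mul_of_one_le_right hp (le_add_of_nonneg_right (distToRegion_nonneg Λ x))
  · rw [hz x (fun h' => hx (Finset.mem_coe.mp h')), abs_zero]
    exact mul_nonneg hp (add_nonneg zero_le_one (distToRegion_nonneg Λ x))

end Kernel

end Literature.MathematicalPhysics.QuantumFieldTheory.Balaban1983to89.B1Eq324BenfattoClassPresentation
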